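import Summits.AtomisticToContinuum.FouriersLaw.Theorems.OddSectorIrreversibilityTapLeakBoundBlockCone
import Summits.AtomisticToContinuum.FouriersLaw.Theorems.ParityLiouvilleSeedWindowLimitContinuity

/-!
# `TapLeakBound` (stmt-AtomisticToContinuum-15159), line `SketchIdeator2`: block light cone — the transported current

Helper file (`--supports stmt-AtomisticToContinuum-15159`) for crux
P = `Summit.AtomisticToContinuum.FouriersLaw.Theses.OddSectorIrreversibility.TapLeakBound`, registered stub `stub_kickCone`
(C′ `ResampledKickCone`). Companion of `…BlockConePrelim/Site/BlockCone.lean` (the deterministic, `N`-uniform block light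
cone of the closed pinned chain): here the site discrepancies are turned into the object C′ integrates, the difference of
the TRANSPORTED BOND CURRENT `j_i ∘ Φ_t` between the kicked and the unkicked trajectory:

* (closed form `j_i = -½(p_i + p_{i+1}) V'(q_{i+1} - q_i)`, `0` on the phantom bond: the landed `WindowLimit.bondCurrent_eq_dite`);
* `abs_dV_le_of_box` — `|V'(r)| ≤ 2R + 8βR³` for `|r| ≤ 2R`;
* `abs_bondCurrent_sub_le` — on a position box at the sites `i, i+1` and a momentum cap `P` for the second point:
  `|j_i(z) - j_i(z')| ≤ (R + 4βR³)(|δp_i| + |δp_{i+1}|) + P Λ² (|δq_i| + |δq_{i+1}|)`;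
* `kick_current_le_of_box` (registered sub-goal `stub_blockKickCurrent`) — with the block light cone at the sites `i` and
  `i+1 ≤ L`: `|j_i(Φ_t x) - j_i(Φ_t y)| ≤ (R + 4βR³ + PΛ)·[(θ^i + θ^{i+1})|p_0 - p_0'| + 2RΛ²(θ^{|L-i|} + θ^{|L-i-1|})t]·e^{Λ(4+2/θ)t}`,
  uniformly in `N` — the deterministic input of any energy-truncated ("cold cone") bound on the stub's integrand.

References: folklore (Lieb–Robinson-type bounds for classical lattices, MPPT 1978 / BCDM 2007 / Raz–Sims 2009, finite-block form).
Nothing here closes the item.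
-/

noncomputable section

open MeasureTheory Filter Topology Set Function Metric
open scoped NNReal

namespace Summit.AtomisticToContinuum.FouriersLaw.Theorems.OddSectorIrreversibility.TapLeak

open Literature.MathematicalPhysics.KineticTheory.HeatConduction
open Literature.MathematicalPhysics.KineticTheory

/-! ### §7 The bond current on a box -/

/-- `|V'(r)| = |r + βr³| ≤ 2R + 8βR³` for `|r| ≤ 2R`, `β ≥ 0`. [folklore] -/
theorem abs_dV_le_of_box {β R r : ℝ} (hβ : 0 ≤ β) (hr : |r| ≤ 2 * R) :
    |r + β * r ^ 3| ≤ 2 * R + 8 * β * R ^ 3 := by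
  have h3 : |r| ^ 3 ≤ (2 * R) ^ 3 := pow_le_pow_left₀ (abs_nonneg r) hr 3
  calc |r + β * r ^ 3| ≤ |r| + |β * r ^ 3| := abs_add_le _ _
    _ = |r| + β * |r| ^ 3 := by rw [abs_mul, abs_of_nonneg hβ, abs_pow]
    _ ≤ 2 * R + β * (2 * R) ^ 3 := by gcongr
    _ = 2 * R + 8 * β * R ^ 3 := by ring

/-- **The current difference on a box.** For the pinned chain (`lam, β ≥ 0`), two phase points whose positions at the
sites `i`, `i+1` are bounded by `R`, the momenta of the SECOND point at `i`, `i+1` bounded by `P ≥ 0`, and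
`Λ² ≥ 1 + 12βR²`: `|j_i(z) - j_i(z')| ≤ (R + 4βR³)(|δp_i| + |δp_{i+1}|) + P Λ² (|δq_i| + |δq_{i+1}|)`
(all four discrepancy terms read `0` on the phantom bond `i = N-1`, where `j_i ≡ 0`). [folklore] -/
theorem abs_bondCurrent_sub_le {ω₂ lam β : ℝ} (hβ : 0 ≤ β) {N : ℕ} {R P Λ : ℝ} (hP : 0 ≤ P)
    (hΛV : 1 + 12 * β * R ^ 2 ≤ Λ ^ 2) (z z' : PhaseSpace N) (i : Fin N) (hi : i.val + 1 < N)
    (hq : |z.1 i| ≤ R ∧ |z'.1 i| ≤ R) (hq1 : |z.1 ⟨i.val + 1, hi⟩| ≤ R ∧ |z'.1 ⟨i.val + 1, hi⟩| ≤ R)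
    (hp' : |z'.2 i| ≤ P ∧ |z'.2 ⟨i.val + 1, hi⟩| ≤ P) :
    |(pinnedChain ω₂ lam β 0).bondCurrent N i z - (pinnedChain ω₂ lam β 0).bondCurrent N i z'| ≤
      (R + 4 * β * R ^ 3) * (|z.2 i - z'.2 i| + |z.2 ⟨i.val + 1, hi⟩ - z'.2 ⟨i.val + 1, hi⟩|) +
        P * Λ ^ 2 * (|z.1 i - z'.1 i| + |z.1 ⟨i.val + 1, hi⟩ - z'.1 ⟨i.val + 1, hi⟩|) := by
  set Pc := pinnedChain ω₂ lam β 0 with hPc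
  have hV' : ∀ r, deriv Pc.V r = r + β * r ^ 3 := fun r => pinnedChain_deriv_V ω₂ lam β 0 r
  rw [WindowLimit.bondCurrent_eq_dite Pc N i z, WindowLimit.bondCurrent_eq_dite Pc N i z', dif_pos hi, dif_pos hi, hV', hV']
  set j1 : Fin N := ⟨i.val + 1, hi⟩ with hj1
  set r := z.1 j1 - z.1 i with hr
  set r' := z'.1 j1 - z'.1 i with hr'
  set A := z.2 i + z.2 j1 with hA
  set A' := z'.2 i + z'.2 j1 with hA'
  have hrb : |r| ≤ 2 * R := by rw [hr]; exact (abs_sub _ _).trans (by linarith [hq.1, hq1.1])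
  have hrb' : |r'| ≤ 2 * R := by rw [hr']; exact (abs_sub _ _).trans (by linarith [hq.2, hq1.2])
  -- the two pieces
  have hVr : |r + β * r ^ 3| ≤ 2 * R + 8 * β * R ^ 3 := abs_dV_le_of_box hβ hrb
  have hVlip : |(r + β * r ^ 3) - (r' + β * r' ^ 3)| ≤ Λ ^ 2 * (|z.1 i - z'.1 i| + |z.1 j1 - z'.1 j1|) := by
    refine (abs_dV_sub_dV_le hβ hrb hrb').trans ?_
    have h1 : 1 + 3 * β * (2 * R) ^ 2 = 1 + 12 * β * R ^ 2 := by ring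
    rw [h1]
    have h2 : |r - r'| ≤ |z.1 i - z'.1 i| + |z.1 j1 - z'.1 j1| := by
      have : r - r' = (z.1 j1 - z'.1 j1) - (z.1 i - z'.1 i) := by rw [hr, hr']; ring
      rw [this]
      exact (abs_sub _ _).trans (le_of_eq (add_comm _ _))
    have hΛ2 : 0 ≤ Λ ^ 2 := sq_nonneg _
    calc (1 + 12 * β * R ^ 2) * |r - r'| ≤ Λ ^ 2 * |r - r'| := mul_le_mul_of_nonneg_right hΛV (abs_nonneg _)
      _ ≤ Λ ^ 2 * (|z.1 i - z'.1 i| + |z.1 j1 - z'.1 j1|) := mul_le_mul_of_nonneg_left h2 hΛ2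
  have hAA : |A - A'| ≤ |z.2 i - z'.2 i| + |z.2 j1 - z'.2 j1| := by
    have : A - A' = (z.2 i - z'.2 i) + (z.2 j1 - z'.2 j1) := by rw [hA, hA']; ring
    rw [this]; exact abs_add_le _ _
  have hA'b : |A'| ≤ 2 * P := by rw [hA']; exact (abs_add_le _ _).trans (by linarith [hp'.1, hp'.2])
  -- split `-(A/2)V(r) + (A'/2)V(r') = -((A - A')/2) V(r) - (A'/2)(V(r) - V(r'))`
  have hsplit : -(A / 2 * (r + β * r ^ 3)) - -(A' / 2 * (r' + β * r' ^ 3)) =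
      -((A - A') / 2 * (r + β * r ^ 3)) - A' / 2 * ((r + β * r ^ 3) - (r' + β * r' ^ 3)) := by ring
  rw [hsplit]
  refine (abs_sub _ _).trans ?_
  rw [abs_neg, abs_mul, abs_mul, abs_div, abs_div, abs_two]
  have h1 : |A - A'| / 2 * |r + β * r ^ 3| ≤ (|z.2 i - z'.2 i| + |z.2 j1 - z'.2 j1|) / 2 * (2 * R + 8 * β * R ^ 3) :=
    mul_le_mul (by linarith) hVr (abs_nonneg _) (by positivity)
  have h2 : |A'| / 2 * |(r + β * r ^ 3) - (r' + β * r' ^ 3)| ≤ P * (Λ ^ 2 * (|z.1 i - z'.1 i| + |z.1 j1 - z'.1 j1|)) :=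
    mul_le_mul (by linarith) hVlip (abs_nonneg _) hP
  have e1 : (|z.2 i - z'.2 i| + |z.2 j1 - z'.2 j1|) / 2 * (2 * R + 8 * β * R ^ 3) =
      (R + 4 * β * R ^ 3) * (|z.2 i - z'.2 i| + |z.2 j1 - z'.2 j1|) := by ring
  have e2 : P * (Λ ^ 2 * (|z.1 i - z'.1 i| + |z.1 j1 - z'.1 j1|)) = P * Λ ^ 2 * (|z.1 i - z'.1 i| + |z.1 j1 - z'.1 j1|) := by
    ring
  linarith

/-! ### §8 The kicked current inside the block light cone -/

section Block

open Summit.AtomisticToContinuum.FouriersLaw.Theorems.ClosedConeSensitivity.Negative.ZeroFrictionDictionary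
open Summit.AtomisticToContinuum.FouriersLaw.Theorems.OddSectorIrreversibility.Corrector

variable {ω₂ lam β : ℝ} (hω : 0 < ω₂) (hl : 0 ≤ lam) (hβ : 0 ≤ β) {N : ℕ} (x y : PhaseSpace N)
  (dq dp : ℕ → ℝ → ℝ)
  (hdq : ∀ n τ, dq n τ = if h : n < N then
    |(detFlow ω₂ lam β N τ x).1 ⟨n, h⟩ - (detFlow ω₂ lam β N τ y).1 ⟨n, h⟩| else 0)
  (hdp : ∀ n τ, dp n τ = if h : n < N then
    |(detFlow ω₂ lam β N τ x).2 ⟨n, h⟩ - (detFlow ω₂ lam β N τ y).2 ⟨n, h⟩| else 0)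
include hω hl hβ hdq hdp

/-- **THE KICKED CURRENT INSIDE THE BLOCK LIGHT CONE.** Initial data differing only in the contact momentum
(`y = (q, p[0 ↦ p'])`), positions of both trajectories boxed by `R` on the sites `≤ L+1` during `[0, s]`, momenta of the
kicked trajectory at the bond sites `i, i+1` capped by `P` at time `t ∈ [0, s]`, `i + 1 ≤ L`, `i + 1 < N`:
`|j_i(Φ_t x) - j_i(Φ_t y)| ≤ (R + 4βR³ + PΛ)·[(θ^i + θ^{i+1})|p_0 - p'| + 2RΛ²(θ^{|L-i|} + θ^{|L-(i+1)|}) t]·e^{Λ(4+2/θ)t}`,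
uniformly in `N`. [folklore] -/
theorem kick_current_le_of_box {R P Λ θ : ℝ} {L i : ℕ} {s : ℝ} (hR : 0 ≤ R) (hP : 0 ≤ P) (hΛ1 : 1 ≤ Λ)
    (hΛU : |ω₂| + 3 * lam * R ^ 2 ≤ Λ ^ 2) (hΛV : 1 + 12 * β * R ^ 2 ≤ Λ ^ 2) (hθ0 : 0 < θ) (hθ1 : θ ≤ 1)
    (hiL : i + 1 ≤ L) (hiN : i + 1 < N) (p' : ℝ)
    (hy : y = (x.1, Function.update x.2 ⟨0, by omega⟩ p'))
    (hbox : ∀ τ ∈ Icc 0 s, ∀ (n : ℕ) (h : n < N), n ≤ L + 1 →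
      |(detFlow ω₂ lam β N τ x).1 ⟨n, h⟩| ≤ R ∧ |(detFlow ω₂ lam β N τ y).1 ⟨n, h⟩| ≤ R)
    {t : ℝ} (ht : t ∈ Icc 0 s)
    (hmom : |(detFlow ω₂ lam β N t y).2 ⟨i, by omega⟩| ≤ P ∧ |(detFlow ω₂ lam β N t y).2 ⟨i + 1, hiN⟩| ≤ P) :
    |(pinnedChain ω₂ lam β 0).bondCurrent N ⟨i, by omega⟩ (detFlow ω₂ lam β N t x) -
        (pinnedChain ω₂ lam β 0).bondCurrent N ⟨i, by omega⟩ (detFlow ω₂ lam β N t y)| ≤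
      (R + 4 * β * R ^ 3 + P * Λ) *
        ((θ ^ i + θ ^ (i + 1)) * |x.2 ⟨0, by omega⟩ - p'| +
          2 * R * Λ ^ 2 * (θ ^ Nat.dist L i + θ ^ Nat.dist L (i + 1)) * t) * Real.exp (Λ * (4 + 2 * θ⁻¹) * t) := by
  have hN : 0 < N := by omega
  have hiN' : i < N := by omega
  have hΛ0 : 0 ≤ Λ := zero_le_one.trans hΛ1
  -- the block cone at the two bond sites
  have hi := kick_discrepancy_le_of_box hω hl hβ x y dq dp hdq hdp hR hΛ1 hΛU hΛV hθ0 hθ1 (by omega : i ≤ L) hN p' hy hbox ht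
  have hi1 := kick_discrepancy_le_of_box hω hl hβ x y dq dp hdq hdp hR hΛ1 hΛU hΛV hθ0 hθ1 hiL hN p' hy hbox ht
  -- the pointwise current bound
  set z := detFlow ω₂ lam β N t x with hz
  set z' := detFlow ω₂ lam β N t y with hz'
  have hq := hbox t ht i hiN' (by omega)
  have hq1 := hbox t ht (i + 1) hiN (by omega)
  have hcur := abs_bondCurrent_sub_le (ω₂ := ω₂) (lam := lam) hβ hP hΛV z z' ⟨i, hiN'⟩ hiN hq hq1 hmom
  refine hcur.trans ?_
  -- rewrite the four discrepancies through `dq`, `dp`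
  have eqi : |z.1 ⟨i, hiN'⟩ - z'.1 ⟨i, hiN'⟩| = dq i t := by rw [hdq, dif_pos hiN']
  have eqi1 : |z.1 ⟨i + 1, hiN⟩ - z'.1 ⟨i + 1, hiN⟩| = dq (i + 1) t := by rw [hdq, dif_pos hiN]
  have epi : |z.2 ⟨i, hiN'⟩ - z'.2 ⟨i, hiN'⟩| = dp i t := by rw [hdp, dif_pos hiN']
  have epi1 : |z.2 ⟨i + 1, hiN⟩ - z'.2 ⟨i + 1, hiN⟩| = dp (i + 1) t := by rw [hdp, dif_pos hiN]
  rw [eqi, eqi1, epi, epi1]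
  -- `(R+4βR³)(dp_i + dp_{i+1}) + PΛ²(dq_i + dq_{i+1}) ≤ (R + 4βR³ + PΛ)(a_i + a_{i+1})`
  have hq0 : ∀ m τ, 0 ≤ dq m τ := dq_nonneg x y dq hdq
  have hp0 : ∀ m τ, 0 ≤ dp m τ := dp_nonneg x y dp hdp
  set ai := Λ * dq i t + dp i t with hai
  set ai1 := Λ * dq (i + 1) t + dp (i + 1) t with hai1
  have hcomb : (R + 4 * β * R ^ 3) * (dp i t + dp (i + 1) t) + P * Λ ^ 2 * (dq i t + dq (i + 1) t) ≤
      (R + 4 * β * R ^ 3 + P * Λ) * (ai + ai1) := by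
    rw [hai, hai1]
    have := hq0 i t; have := hq0 (i + 1) t; have := hp0 i t; have := hp0 (i + 1) t
    have hRR : 0 ≤ R + 4 * β * R ^ 3 := by positivity
    have hPΛ : 0 ≤ P * Λ := mul_nonneg hP hΛ0
    nlinarith [mul_nonneg hRR (mul_nonneg hΛ0 (hq0 i t)), mul_nonneg hRR (mul_nonneg hΛ0 (hq0 (i + 1) t)),
      mul_nonneg hPΛ (hp0 i t), mul_nonneg hPΛ (hp0 (i + 1) t)]
  refine hcomb.trans ?_
  have hC0 : 0 ≤ R + 4 * β * R ^ 3 + P * Λ := by positivity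
  have hsum : ai + ai1 ≤ ((θ ^ i + θ ^ (i + 1)) * |x.2 ⟨0, hN⟩ - p'| +
      2 * R * Λ ^ 2 * (θ ^ Nat.dist L i + θ ^ Nat.dist L (i + 1)) * t) * Real.exp (Λ * (4 + 2 * θ⁻¹) * t) := by
    have e : ((θ ^ i + θ ^ (i + 1)) * |x.2 ⟨0, hN⟩ - p'| +
        2 * R * Λ ^ 2 * (θ ^ Nat.dist L i + θ ^ Nat.dist L (i + 1)) * t) * Real.exp (Λ * (4 + 2 * θ⁻¹) * t) =
        (θ ^ i * |x.2 ⟨0, hN⟩ - p'| + 2 * R * Λ ^ 2 * θ ^ Nat.dist L i * t) * Real.exp (Λ * (4 + 2 * θ⁻¹) * t) +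
        (θ ^ (i + 1) * |x.2 ⟨0, hN⟩ - p'| + 2 * R * Λ ^ 2 * θ ^ Nat.dist L (i + 1) * t) *
          Real.exp (Λ * (4 + 2 * θ⁻¹) * t) := by ring
    rw [e]
    exact add_le_add hi hi1
  simpa only [mul_assoc] using mul_le_mul_of_nonneg_left hsum hC0

end Block


/-! ### Registered sub-goal of the line (closed form of `kick_current_le_of_box`) -/

/-- **Sub-goal `stub_blockKickCurrent`** (registered on the crux item for this helper file; closed `∀`-form of
`kick_current_le_of_box`): the kicked transported current inside the deterministic block light cone. [folklore] -/
theorem stub_blockKickCurrent : ∀ (ω₂ lam β : ℝ), 0 < ω₂ → 0 ≤ lam → 0 ≤ β → ∀ (N : ℕ) (x y : PhaseSpace N) (dq dp : ℕ → ℝ → ℝ), (∀ (n : ℕ) (τ : ℝ), dq n τ = if h : n < N then |(Summit.AtomisticToContinuum.FouriersLaw.Theorems.ClosedConeSensitivity.Negative.ZeroFrictionDictionary.detFlow ω₂ lam β N τ x).1 ⟨n, h⟩ - (Summit.AtomisticToContinuum.FouriersLaw.Theorems.ClosedConeSensitivity.Negative.ZeroFrictionDictionary.detFlow ω₂ lam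 β N τ y).1 ⟨n, h⟩| else 0) → (∀ (n : ℕ) (τ : ℝ), dp n τ = if h : n < N then |(Summit.AtomisticToContinuum.FouriersLaw.Theorems.ClosedConeSensitivity.Negative.ZeroFrictionDictionary.detFlow ω₂ lam β N τ x).2 ⟨n, h⟩ - (Summit.AtomisticToContinuum.FouriersLaw.Theorems.ClosedConeSensitivity.Negative.ZeroFrictionDictionary.detFlow ω₂ lam β N τ y).2 ⟨n, h⟩| else 0) → ∀ (R P Λ θ : ℝ) (L i : ℕ) (s : ℝ), 0 ≤ R → 0 ≤ P → 1 ≤ Λ → |ω₂| + 3 * lam * R ^ 2 ≤ Λ ^ 2 → 1 + 12 * β * R ^ 2 ≤ Λ ^ 2 → 0 < θ → θ ≤ 1 → i + 1 ≤ L → ∀ (hiN : i + 1 < N) (p' : ℝ), y = (x.1, Function.update x.2 ⟨0, by omega⟩ p') → (∀ τ ∈ Set.Icc (0 : ℝ) s, ∀ (n : ℕ) (h : n < N), n ≤ L + 1 → |(Summit.AtomisticToContinuum.FouriersLaw.Theorems.ClosedConeSensitivity.Negative.ZeroFrictionDictionary.detFlow ω₂ lam β N τ x).1 ⟨n, h⟩|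 ≤ R ∧ |(Summit.AtomisticToContinuum.FouriersLaw.Theorems.ClosedConeSensitivity.Negative.ZeroFrictionDictionary.detFlow ω₂ lam β N τ y).1 ⟨n, h⟩| ≤ R) → ∀ (t : ℝ), t ∈ Set.Icc (0 : ℝ) s → (|(Summit.AtomisticToContinuum.FouriersLaw.Theorems.ClosedConeSensitivity.Negative.ZeroFrictionDictionary.detFlow ω₂ lam β N t y).2 ⟨i, by omega⟩| ≤ P ∧ |(Summit.AtomisticToContinuum.FouriersLaw.Theorems.ClosedConeSensitivity.Negative.ZeroFrictionDictionary.detFlow ω₂ lam β N t y).2 ⟨i + 1, hiN⟩| ≤ P) → |(pinnedChain ω₂ lam β 0).bondCurrent N ⟨i, by omega⟩ (Summit.AtomisticToContinuum.FouriersLaw.Theorems.ClosedConeSensitivity.Negative.ZeroFrictionDictionary.detFlow ω₂ lam β N t x) - (pinnedChain ω₂ lam β 0).bondCurrent N ⟨i, by omega⟩ (Summit.AtomisticToContinuum.FouriersLaw.Theorems.ClosedConeSensitivity.Negative.ZeroFrictionDictionary.detFlow ω₂ lam β N t y)| ≤ (R + 4 * β * R ^ 3 + P * Λ) * ((θ ^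 i + θ ^ (i + 1)) * |x.2 ⟨0, by omega⟩ - p'| + 2 * R * Λ ^ 2 * (θ ^ Nat.dist L i + θ ^ Nat.dist L (i + 1)) * t) * Real.exp (Λ * (4 + 2 * θ⁻¹) * t) :=
  fun _ _ _ hω hl hβ _ x y dq dp hdq hdp _ _ _ _ _ _ _ hR hP hΛ1 hΛU hΛV hθ0 hθ1 hiL hiN p' hy hbox _ ht hmom =>
    kick_current_le_of_box hω hl hβ x y dq dp hdq hdp hR hP hΛ1 hΛU hΛV hθ0 hθ1 hiL hiN p' hy hbox ht hmom

end Summit.AtomisticToContinuum.FouriersLaw.Theorems.OddSectorIrreversibility.TapLeak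

end
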